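import Mathlib
import Summits.NavierStokesRegularity.NavierStokesRegularity.Theorems.DssFarFieldSlavingBlowupTypeIDssProfileGaussianSmallTypeIBounds
import Summits.NavierStokesRegularity.NavierStokesRegularity.Theorems.DssFarFieldSlavingBlowupTypeIDssProfileGaussianGapCore
import HarnessLib

/-!
# The Gaussian two-constant dissipation inequality and Liouville theorem for the similarity vorticity
  equation (theory T31′, core; pub-ns-dss T38/T31 scope Row 4; route `DssFarFieldSlaving`, crux
  `BlowupTypeIDssProfile`, stmt-NavierStokesRegularity-0155 — SUPPORT, label-free core; typer seat g7,
  2026-08-23; lead A230 (b)/A231 (3))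

HONEST FRAMING. Label-free analysis core about a HYPOTHETICAL object (a bounded smooth solution family
`Ω(s), U(s)` of the backward similarity vorticity equation with `div U = div Ω = 0`): IF `‖U‖ ≤ Mt`,
`‖y‖‖U(s,y)‖ ≤ A` with `Mt² + 3A < 4`, and the Gaussian enstrophy is bounded on `s ∈ ℝ`, THEN `Ω ≡ 0`.
Same kit as the T31-G core (`…GaussianSmallTypeICore`): O-U cancellation, Gaussian transport and
stretching identities, expansion and term bounds of `…GaussianSmallTypeIBounds`; here the two
`y`-weighted terms are bounded POINTWISE by the space-only constant `A` (no Hermite moment bound):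
`½E′ ≤ −D − E + ¾A·E + Mt√D√E ≤ −(1 − Mt²/4 − 3A/4)E`. No Type-I class appears in this file; no
census word; nothing numeric; nothing here bears on Navier–Stokes regularity or blow-up. Derivation:
theory seat T31′ (LIOUVILLE-SIDE §8; theory g4 2026-08-22, ×2 theory g10 2026-08-23).
-/

noncomputable section

set_option linter.dupNamespace false

namespace Summit.NavierStokesRegularity.NavierStokesRegularity.Theorems.GaussianGap

open Set Function Filter MeasureTheory InnerProductSpace Real Metric
open scoped RealInnerProductSpace Laplacian ContDiff Topology BigOperators
open Literature.Analysis Literature.Analysis.FluidPDE Literature.Analysis.UnboundedOperators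
open Summit.NavierStokesRegularity.NavierStokesRegularity.Theorems

/-- **The inward-flux term under a space-only bound:** `−∫K⟪y,U⟫|Ω|² ≤ A ∫K|Ω|²` for
`‖y‖‖U(y)‖ ≤ A`. [folklore] -/
theorem neg_integral_heatKernel_flux_le_of_weighted {Ω U : EuclideanSpace ℝ (Fin 3) → EuclideanSpace ℝ (Fin 3)}
    {K₀ A : ℝ} (hΩ : ContDiff ℝ 1 Ω) (hU : ContDiff ℝ 1 U) (h0 : ∀ y, ‖Ω y‖ ≤ K₀)
    (h3 : ∀ y, ‖U y‖ ≤ K₀) (hA : ∀ y, ‖y‖ * ‖U y‖ ≤ A) :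
    -(∫ y, heatKernel 1 y * (⟪y, U y⟫ * ‖Ω y‖ ^ 2)) ≤ A * ∫ y, heatKernel 1 y * ‖Ω y‖ ^ 2 := by
  have hK0 : 0 ≤ K₀ := (norm_nonneg _).trans (h0 0)
  have cK : Continuous (heatKernel (E := EuclideanSpace ℝ (Fin 3)) 1) := continuous_heatKernel 1
  have cΩ : Continuous Ω := hΩ.continuous
  have cU : Continuous U := hU.continuous
  have iFL : Integrable fun y => heatKernel 1 y * (⟪y, U y⟫ * ‖Ω y‖ ^ 2) := by
    refine integrable_of_le_poly_heatKernel (cK.mul ((continuous_id.inner cU).mul (cΩ.norm.pow 2)))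
      (C := K₀ * K₀ ^ 2) (N := 1) fun y => ?_
    rw [Real.norm_eq_abs, abs_mul, abs_of_pos (heatKernel_one_pos y), abs_mul,
      abs_of_nonneg (by positivity : (0:ℝ) ≤ ‖Ω y‖ ^ 2)]
    have e1 : |⟪y, U y⟫| ≤ (1 + ‖y‖) * K₀ := (abs_real_inner_le_norm y (U y)).trans
      (mul_le_mul (by linarith [norm_nonneg y]) (h3 y) (norm_nonneg _) (by linarith [norm_nonneg y]))
    have e2 : ‖Ω y‖ ^ 2 ≤ K₀ ^ 2 := pow_le_pow_left₀ (norm_nonneg _) (h0 y) 2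
    calc heatKernel 1 y * (|⟪y, U y⟫| * ‖Ω y‖ ^ 2) ≤ heatKernel 1 y * ((1 + ‖y‖) * K₀ * K₀ ^ 2) :=
          mul_le_mul_of_nonneg_left (mul_le_mul e1 e2 (by positivity) (by positivity))
            (heatKernel_one_pos y).le
      _ = K₀ * K₀ ^ 2 * (1 + ‖y‖) ^ 1 * heatKernel 1 y := by ring
  have iZ : Integrable fun y => heatKernel 1 y * ‖Ω y‖ ^ 2 :=
    integrable_of_le_poly_heatKernel (cK.mul (cΩ.norm.pow 2)) (C := K₀ ^ 2) (N := 0) fun y => by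
      rw [Real.norm_eq_abs, abs_mul, abs_of_pos (heatKernel_one_pos y), abs_of_nonneg (by positivity),
        pow_zero, mul_one, mul_comm]
      exact mul_le_mul_of_nonneg_right (pow_le_pow_left₀ (norm_nonneg _) (h0 y) 2)
        (heatKernel_one_pos y).le
  rw [← integral_neg, ← integral_const_mul]
  refine integral_mono iFL.neg (iZ.const_mul A) fun y => ?_
  show -(heatKernel 1 y * (⟪y, U y⟫ * ‖Ω y‖ ^ 2)) ≤ A * (heatKernel 1 y * ‖Ω y‖ ^ 2)
  have e1 : -⟪y, U y⟫ ≤ A := by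
    calc -⟪y, U y⟫ ≤ |⟪y, U y⟫| := neg_le_abs _
      _ ≤ ‖y‖ * ‖U y‖ := abs_real_inner_le_norm _ _
      _ ≤ A := hA y
  have hK := (heatKernel_one_pos y).le
  have hΩ2 : 0 ≤ ‖Ω y‖ ^ 2 := sq_nonneg _
  nlinarith [mul_le_mul_of_nonneg_right e1 hΩ2, mul_nonneg hK hΩ2]

/-- **The cross term under a space-only bound:** `∫K⟪y,Ω⟫⟪U,Ω⟫ ≤ A ∫K|Ω|²` for `‖y‖‖U(y)‖ ≤ A`.
[folklore] -/
theorem integral_heatKernel_cross_moment_le_of_weighted {Ω U : EuclideanSpace ℝ (Fin 3) → EuclideanSpace ℝ (Fin 3)}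
    {K₀ A : ℝ} (hΩ : ContDiff ℝ 1 Ω) (hU : ContDiff ℝ 1 U) (h0 : ∀ y, ‖Ω y‖ ≤ K₀)
    (h3 : ∀ y, ‖U y‖ ≤ K₀) (hA : ∀ y, ‖y‖ * ‖U y‖ ≤ A) :
    ∫ y, heatKernel 1 y * (⟪y, Ω y⟫ * ⟪U y, Ω y⟫) ≤ A * ∫ y, heatKernel 1 y * ‖Ω y‖ ^ 2 := by
  have hK0 : 0 ≤ K₀ := (norm_nonneg _).trans (h0 0)
  have cK : Continuous (heatKernel (E := EuclideanSpace ℝ (Fin 3)) 1) := continuous_heatKernel 1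
  have cΩ : Continuous Ω := hΩ.continuous
  have cU : Continuous U := hU.continuous
  have iYO : Integrable fun y => heatKernel 1 y * (⟪y, Ω y⟫ * ⟪U y, Ω y⟫) := by
    refine integrable_of_le_poly_heatKernel (cK.mul ((continuous_id.inner cΩ).mul (cU.inner cΩ)))
      (C := K₀ * (K₀ * K₀)) (N := 1) fun y => ?_
    rw [Real.norm_eq_abs, abs_mul, abs_of_pos (heatKernel_one_pos y), abs_mul]
    have e1 : |⟪y, Ω y⟫| ≤ (1 + ‖y‖) * K₀ := (abs_real_inner_le_norm _ _).trans
      (mul_le_mul (by linarith [norm_nonneg y]) (h0 y) (norm_nonneg _) (by linarith [norm_nonneg y]))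
    have e2 : |⟪U y, Ω y⟫| ≤ K₀ * K₀ :=
      (abs_real_inner_le_norm _ _).trans (mul_le_mul (h3 y) (h0 y) (norm_nonneg _) hK0)
    calc heatKernel 1 y * (|⟪y, Ω y⟫| * |⟪U y, Ω y⟫|)
        ≤ heatKernel 1 y * (((1 + ‖y‖) * K₀) * (K₀ * K₀)) :=
          mul_le_mul_of_nonneg_left (mul_le_mul e1 e2 (abs_nonneg _) (by positivity))
            (heatKernel_one_pos y).le
      _ = K₀ * (K₀ * K₀) * (1 + ‖y‖) ^ 1 * heatKernel 1 y := by ring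
  have iZ : Integrable fun y => heatKernel 1 y * ‖Ω y‖ ^ 2 :=
    integrable_of_le_poly_heatKernel (cK.mul (cΩ.norm.pow 2)) (C := K₀ ^ 2) (N := 0) fun y => by
      rw [Real.norm_eq_abs, abs_mul, abs_of_pos (heatKernel_one_pos y), abs_of_nonneg (by positivity),
        pow_zero, mul_one, mul_comm]
      exact mul_le_mul_of_nonneg_right (pow_le_pow_left₀ (norm_nonneg _) (h0 y) 2)
        (heatKernel_one_pos y).le
  rw [← integral_const_mul]
  refine integral_mono iYO (iZ.const_mul A) fun y => ?_
  show heatKernel 1 y * (⟪y, Ω y⟫ * ⟪U y, Ω y⟫) ≤ A * (heatKernel 1 y * ‖Ω y‖ ^ 2)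
  have e1 : ⟪y, Ω y⟫ * ⟪U y, Ω y⟫ ≤ A * ‖Ω y‖ ^ 2 := by
    calc ⟪y, Ω y⟫ * ⟪U y, Ω y⟫ ≤ |⟪y, Ω y⟫ * ⟪U y, Ω y⟫| := le_abs_self _
      _ = |⟪y, Ω y⟫| * |⟪U y, Ω y⟫| := abs_mul _ _
      _ ≤ (‖y‖ * ‖Ω y‖) * (‖U y‖ * ‖Ω y‖) :=
          mul_le_mul (abs_real_inner_le_norm _ _) (abs_real_inner_le_norm _ _) (abs_nonneg _)
            (by positivity)
      _ = (‖y‖ * ‖U y‖) * ‖Ω y‖ ^ 2 := by ring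
      _ ≤ A * ‖Ω y‖ ^ 2 := mul_le_mul_of_nonneg_right (hA y) (sq_nonneg _)
  have hK := (heatKernel_one_pos y).le
  nlinarith [mul_le_mul_of_nonneg_left e1 hK]

/-- **The Gaussian-enstrophy dissipation inequality for one slice under a time-only AND a space-only
bound** (theory T31′, the «Gaussian two-constant» form): for `Ω ∈ C²`, `U ∈ C¹`, both divergence
free, bounds `K₀`, `‖U‖ ≤ Mt` (`Mt ≥ 0`) and `‖y‖‖U(y)‖ ≤ A`,
`2∫K⟪Ω, ΔΩ − Ω − ½DΩ[y] − DΩ[U] + DU[Ω]⟫ ≤ −2(1 − Mt²/4 − 3A/4) ∫K|Ω|²`: the two `y`-weighted terms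
cost `¾A·E` directly (no moment bound) and the stretching remainder `Mt√D√E ≤ D + (Mt²/4)E`.
[this file; theory T31′ (LIOUVILLE-SIDE §8), typed by the typer] -/
theorem gaussianEnstrophy_pairing_le_of_twoConstant {Ω U : EuclideanSpace ℝ (Fin 3) → EuclideanSpace ℝ (Fin 3)}
    {K₀ Mt A : ℝ} (hΩ : ContDiff ℝ 2 Ω) (hU : ContDiff ℝ 1 U) (hdiv : VectorCalculus.IsDivFree U)
    (hdivΩ : VectorCalculus.IsDivFree Ω)
    (h0 : ∀ y, ‖Ω y‖ ≤ K₀) (h1 : ∀ y, ‖fderiv ℝ Ω y‖ ≤ K₀) (h2 : ∀ y, ‖iteratedFDeriv ℝ 2 Ω y‖ ≤ K₀)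
    (h3 : ∀ y, ‖U y‖ ≤ K₀) (h4 : ∀ y, ‖fderiv ℝ U y‖ ≤ K₀)
    (hMt0 : 0 ≤ Mt) (hUM : ∀ y, ‖U y‖ ≤ Mt) (hA : ∀ y, ‖y‖ * ‖U y‖ ≤ A) :
    ∫ y, heatKernel 1 y * (2 * ⟪Ω y,
        (Δ Ω) y - Ω y - (1 / 2 : ℝ) • fderiv ℝ Ω y y - fderiv ℝ Ω y (U y) + fderiv ℝ U y (Ω y)⟫) ≤
      -(2 * (1 - Mt ^ 2 / 4 - 3 * A / 4)) * ∫ y, heatKernel 1 y * ‖Ω y‖ ^ 2 := by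
  have hΩ1 : ContDiff ℝ 1 Ω := hΩ.of_le (by norm_num)
  have hOU := integral_heatKernel_inner_laplacian_sub_half_fderiv hΩ h0 h1 h2
  have hTR := integral_heatKernel_inner_convect hU hΩ1 hdiv h3 h0 h1
  have hST := integral_heatKernel_inner_stretching_eq hU hΩ1 hdivΩ h3 h0 h4 h1
  have hexp := gaussianEnstrophy_pairing_expand hΩ hU h0 h1 h2 h3 h4
  have hDle := integral_heatKernel_norm_fderiv_sq_le_sum hΩ1 h1
  have hAt := neg_integral_heatKernel_inner_fderiv_apply_le hΩ1 hU h0 h1 h3 hMt0 hUM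
  have hB1 := neg_integral_heatKernel_flux_le_of_weighted hΩ1 hU h0 h3 hA
  have hB2 := integral_heatKernel_cross_moment_le_of_weighted hΩ1 hU h0 h3 hA
  set E : ℝ := ∫ y, heatKernel 1 y * ‖Ω y‖ ^ 2 with hE
  set Dsum : ℝ := ∑ i, ∫ y, heatKernel 1 y * ‖fderiv ℝ (fun z => Ω z i) y‖ ^ 2 with hDsum
  set Dop : ℝ := ∫ y, heatKernel 1 y * ‖fderiv ℝ Ω y‖ ^ 2 with hDop
  set F : ℝ := ∫ y, heatKernel 1 y * (⟪y, U y⟫ * ‖Ω y‖ ^ 2) with hF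
  set G : ℝ := ∫ y, heatKernel 1 y * (⟪y, Ω y⟫ * ⟪U y, Ω y⟫) with hG
  set T : ℝ := ∫ y, heatKernel 1 y * ⟪U y, fderiv ℝ Ω y (Ω y)⟫ with hT
  have hE0 : 0 ≤ E := integral_nonneg fun y => mul_nonneg (heatKernel_one_pos y).le (by positivity)
  have hDop0 : 0 ≤ Dop := integral_nonneg fun y => mul_nonneg (heatKernel_one_pos y).le (by positivity)
  rw [hexp, hOU, hTR, hST]
  clear hexp hOU hTR hST
  set e : ℝ := Real.sqrt E with he
  set d : ℝ := Real.sqrt Dop with hd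
  have hee : e * e = E := Real.mul_self_sqrt hE0
  have hdd : d * d = Dop := Real.mul_self_sqrt hDop0
  have hYoung : Mt * (d * e) ≤ d * d + Mt ^ 2 / 4 * (e * e) := by
    linarith only [sq_nonneg (d - Mt / 2 * e)]
  have hDs : -Dsum ≤ -(d * d) := by rw [hdd]; linarith only [hDle]
  linear_combination 2 * hDs + (1 / 2 : ℝ) * hB1 + hB2 + 2 * hAt + 2 * hYoung + (Mt ^ 2 / 2) * hee

/-- **The two-constant Liouville theorem for the similarity vorticity equation** (T31′, core form):
as `gaussianSmall_vorticity_liouville` with `‖U‖ ≤ Mt`, `‖y‖‖U‖ ≤ A` and `Mt² + 3A < 4` in place of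
the small-`M` condition. [this file; theory T31′] -/
theorem gaussianTwoConstant_vorticity_liouville
    {Ω U : ℝ → EuclideanSpace ℝ (Fin 3) → EuclideanSpace ℝ (Fin 3)} {Mt A B : ℝ}
    (hΩ2 : ∀ s, ContDiff ℝ 2 (Ω s)) (hU1 : ∀ s, ContDiff ℝ 1 (U s))
    (hdiv : ∀ s, VectorCalculus.IsDivFree (U s)) (hdivΩ : ∀ s, VectorCalculus.IsDivFree (Ω s))
    (hbdd : ∀ s₀ : ℝ, ∃ ε > 0, ∃ K₀ : ℝ, ∀ s ∈ Ioo (s₀ - ε) (s₀ + ε), ∀ y,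
      ‖Ω s y‖ ≤ K₀ ∧ ‖fderiv ℝ (Ω s) y‖ ≤ K₀ ∧ ‖iteratedFDeriv ℝ 2 (Ω s) y‖ ≤ K₀ ∧
        ‖U s y‖ ≤ K₀ ∧ ‖fderiv ℝ (U s) y‖ ≤ K₀)
    (heq : ∀ s y, HasDerivAt (fun σ => Ω σ y)
      ((Δ (Ω s)) y - Ω s y - (1 / 2 : ℝ) • fderiv ℝ (Ω s) y y - fderiv ℝ (Ω s) y (U s y) +
        fderiv ℝ (U s) y (Ω s y)) s)
    (hMt0 : 0 ≤ Mt) (hUM : ∀ s y, ‖U s y‖ ≤ Mt) (hA : ∀ s y, ‖y‖ * ‖U s y‖ ≤ A)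
    (h : Mt ^ 2 + 3 * A < 4)
    (hZb : ∀ s, ∫ y, heatKernel 1 y * ‖Ω s y‖ ^ 2 ≤ B) :
    ∀ s y, Ω s y = 0 := by
  set Z : ℝ → ℝ := fun s => ∫ y, heatKernel 1 y * ‖Ω s y‖ ^ 2 with hZ_def
  set Z' : ℝ → ℝ := fun s => ∫ y, heatKernel 1 y * (2 * ⟪Ω s y,
    (Δ (Ω s)) y - Ω s y - (1 / 2 : ℝ) • fderiv ℝ (Ω s) y y - fderiv ℝ (Ω s) y (U s y) +
      fderiv ℝ (U s) y (Ω s y)⟫) with hZ'_def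
  set κ : ℝ := 1 - Mt ^ 2 / 4 - 3 * A / 4 with hκ
  have hκpos : 0 < κ := by rw [hκ]; linarith
  have hZd : ∀ s, HasDerivAt Z (Z' s) s := by
    intro s
    obtain ⟨ε, hε, K₀, hK⟩ := hbdd s
    exact gaussianEnstrophy_hasDerivAt hΩ2 hU1 hε hK heq
  have hineq : ∀ s, Z' s ≤ -(2 * κ) * Z s := by
    intro s
    obtain ⟨ε, hε, K₀, hK⟩ := hbdd s
    have hKs := hK s (by constructor <;> linarith)
    exact gaussianEnstrophy_pairing_le_of_twoConstant (hΩ2 s) (hU1 s) (hdiv s) (hdivΩ s)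
      (fun y => (hKs y).1) (fun y => (hKs y).2.1) (fun y => (hKs y).2.2.1) (fun y => (hKs y).2.2.2.1)
      (fun y => (hKs y).2.2.2.2) hMt0 (hUM s) (hA s)
  have hZ0 : ∀ s, Z s = 0 := by
    intro s
    have hnn : ∀ σ ≤ s, 0 ≤ Z σ := fun σ _ =>
      integral_nonneg fun y => mul_nonneg (heatKernel_one_pos y).le (by positivity)
    exact eq_zero_of_deriv_le_neg_mul (Z := Z) (Z' := Z') (mul_pos two_pos hκpos) hnn
      (fun σ _ => hZb σ) (fun σ _ => hZd σ) (fun σ _ => hineq σ) s le_rfl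
  intro s y
  obtain ⟨ε, hε, K₀, hK⟩ := hbdd s
  exact eq_zero_of_integral_heatKernel_mul_norm_sq_eq_zero ((hΩ2 s).continuous)
    (fun z => (hK s (by constructor <;> linarith) z).1) (hZ0 s) y


end Summit.NavierStokesRegularity.NavierStokesRegularity.Theorems.GaussianGap
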